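import Mathlib
import HarnessLib
import Summits.NavierStokesRegularity.NavierStokesRegularity.Theorems.TaylorModelRungThreeReadoutFlowPackageV

/-!
# Line `taylor-model` on crux K1b-DR (stmt-NavierStokesRegularity-23954) — (E) supplement F5″: the ORDER-GENERIC
# Taylor model of any box-confined trajectory of any flow package

`IsFlowPackageV`'s (F5′) is stated at the box order `cd.pdeg` with the remainder table `bx.J`.  The revised recipe
(PROPAGATE-V-SPEC-cert1 §2 A) runs the CENTRE at a higher order `pc` (its remainder must be far below the box
remainder).  Nothing new is needed on the flow side: for ANY flow `φ`, any trajectory that solves the window-truncated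
cascade ODE on `[0,T]` (`SolvesOn`) and stays in a box `[lo,hi]` (as (F1′) provides), and ANY order `P` with an
order-`P+1` jet bound `J′` certified over that box, the componentwise Lagrange remainder estimate holds:
`|φ(z)(u) i k − Σ_{n≤P} taylorJet cd.Qb z n i k · u^n| ≤ J′ i k · u^(P+1)` on `[0,T]`.

* `exists_QwBundle` — the window field `Qw cd` is a bundled bilinear map (no stage hypotheses);
* `taylor_of_solvesOn_inBox` — the statement above (proof: `isSolOn_toVec_of_solves` + `abs_sub_taylor_le_of_mem_Icc`).

MODEL-lattice rung TL-M3 only; nothing here is a statement about the Navier–Stokes equations.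
-/

noncomputable section

-- the sub-problem namespace repeats the summit name by design (D-0017)
set_option linter.dupNamespace false

namespace Summit.NavierStokesRegularity.NavierStokesRegularity.Theorems.TaylorModelV

open Set Finset
open Literature.Analysis.FluidPDE.TaoCascade Literature.Analysis.FluidPDE.TaoCascade.TaylorChain
open Summit.NavierStokesRegularity.NavierStokesRegularity.Theorems.TaylorModelMajorant
open Summit.NavierStokesRegularity.NavierStokesRegularity.Theorems.TaylorModelVector
open Summit.NavierStokesRegularity.NavierStokesRegularity.Theorems.TaylorModelReadout

variable {cd : CertData}

/-- The window field `Qw cd` is (the coercion of) a bundled bilinear map — no stage hypotheses needed. [folklore] -/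
theorem exists_QwBundle (cd : CertData) :
    ∃ Qb : (Fin (nW cd) → ℝ) →ₗ[ℝ] (Fin (nW cd) → ℝ) →ₗ[ℝ] Fin (nW cd) → ℝ, ∀ u v, Qb u v = Qw cd u v :=
  ⟨LinearMap.mk₂ ℝ (Qw cd) (fun u₁ u₂ v => (isLinearMap_Qw_left cd v).map_add u₁ u₂)
    (fun r u v => (isLinearMap_Qw_left cd v).map_smul r u) (fun u v₁ v₂ => (isLinearMap_Qw_right cd u).map_add v₁ v₂)
    (fun r u v => (isLinearMap_Qw_right cd u).map_smul r v), fun _ _ => rfl⟩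

/-- **(F5″) ORDER-GENERIC TAYLOR MODEL** of a box-confined trajectory of any flow: see the module docstring.
[folklore] -/
theorem taylor_of_solvesOn_inBox {φ : Flow} {j : ℕ} {z : Fin 4 → ℤ → ℝ} {T : ℝ} (hsol : SolvesOn cd φ j z T)
    {lo hi : Fin 4 → ℤ → ℝ} (hbox : ∀ u ∈ Icc 0 T, InBox cd lo hi (stAt φ j z u)) {P : ℕ} {J' : Fin 4 → ℤ → ℝ}
    (hJ : ∀ y, InBox cd lo hi y → ∀ i k, -cd.Kb ≤ k → k ≤ cd.Ka → |taylorJet cd.Qb y (P + 1) i k| ≤ J' i k) :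
    ∀ u ∈ Icc 0 T, ∀ i k, -cd.Kb ≤ k → k ≤ cd.Ka →
      |stAt φ j z u i k - ∑ n ∈ Finset.range (P + 1), taylorJet cd.Qb z n i k * u ^ n| ≤ J' i k * u ^ (P + 1) := by
  intro u hu i k hk1 hk2
  have hk : -cd.Kb ≤ k ∧ k ≤ cd.Ka := ⟨hk1, hk2⟩
  set c : Fin (nW cd) := eW cd (i, ⟨k, Finset.mem_Icc.2 hk⟩) with hc
  obtain ⟨QwB, hQwB⟩ := exists_QwBundle cd
  -- the trajectory in window coordinates solves `Ψ' = Qw Ψ Ψ`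
  have hS := isSolOn_toVec_of_solves (cd := cd) (z := z) (T := T) (ψ := φ j z) hsol
  have hder : ∀ s ∈ Icc 0 T, HasDerivWithinAt (fun s => toVec cd (fun i k => φ j z i k s))
      (QwB (toVec cd (fun i k => φ j z i k s)) (toVec cd (fun i k => φ j z i k s))) (Icc 0 T) s :=
    fun s hs => by simpa only [hQwB] using hS.2 s hs
  have hbox' : ∀ s ∈ Icc 0 T, toVec cd (fun i k => φ j z i k s) ∈ Icc (toVec cd lo) (toVec cd hi) :=
    fun s hs => toVec_mem_Icc_of_bounds (cd := cd) (hbox s hs)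
  have hT0 : ∀ x : Fin (nW cd) → ℝ, taylorJet (Qw cd) x 0 = x := fun x => taylorJet_zero _ _
  have hTs : ∀ (x : Fin (nW cd) → ℝ) (k : ℕ) c, ((k : ℝ) + 1) * taylorJet (Qw cd) x (k + 1) c =
      ∑ i ∈ Finset.range (k + 1), QwB (taylorJet (Qw cd) x i) (taylorJet (Qw cd) x (k - i)) c :=
    fun x k c => by simpa only [hQwB] using taylorJet_succ_apply (Qw cd) x k c
  have hJ' : ∀ yv ∈ Icc (toVec cd lo) (toVec cd hi), ∀ c', |taylorJet (Qw cd) yv (P + 1) c'| ≤ toVec cd J' c' := by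
    intro yv hyv c'
    have h1 := hJ (ofVec cd yv) (ofVec_window_bounds (cd := cd) hyv) (modeOf cd c') (shellOf cd c')
      (shellOf_mem cd c').1 (shellOf_mem cd c').2
    have h2 := congrFun (toVec_taylorJet (cd := cd) (ofVec cd yv) (P + 1)) c'
    rw [toVec_ofVec] at h2
    simp only [toVec] at h2 ⊢
    rw [← h2]
    exact h1
  have key := abs_sub_taylor_le_of_mem_Icc QwB hT0 hTs hder hbox' hJ' u hu c
  -- back to cascade coordinates
  have e0 : toVec cd (fun i k => φ j z i k 0) = toVec cd z := hS.1
  rw [e0] at key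
  have e1 : ∀ n, taylorJet (Qw cd) (toVec cd z) n c = taylorJet cd.Qb z n i k := by
    intro n
    rw [← toVec_taylorJet]
    simp [toVec, hc, modeOf, shellOf]
  have e2 : toVec cd J' c = J' i k := by simp [toVec, hc, modeOf, shellOf]
  have e3 : toVec cd (fun i k => φ j z i k u) c = stAt φ j z u i k := by simp [toVec, hc, modeOf, shellOf, stAt]
  simp only [e1, e2, e3] at key
  exact key

end Summit.NavierStokesRegularity.NavierStokesRegularity.Theorems.TaylorModelV

end
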